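import Literature.Computability.AlgebraicComplexity.FlatteningBound
import HarnessLib

/-!
# REVIEW-RUNBOOK sanity lemmas — the infimum defining `tensorRank` is a genuine minimum
# (clients `pub-omega`, `pub-mm22`, `pub-tensor` of the ops review-runbook generator; §2 card `tensorRank`)

`Literature.Computability.AlgebraicComplexity.tensorRank t` is `sInf {r : ℕ | t is a sum of r triads}`.
Over `ℕ`, `sInf ∅ = 0` by convention, so every statement through `tensorRank` silently includes the
case of an EMPTY defining set (possible only for infinite index types).  The runbooks' §2 card for
`tensorRank` («Conventional values in reach») asks for the one fact that removes the question for the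
formats the cells use: over FINITE index types the defining set is non-empty (the coordinate
decomposition `t = ∑_{a,b,c} t_{abc} · e_a ⊗ e_b ⊗ e_c` has `|ι|·|κ|·|μ|` triads), hence bounded below and
ATTAINED — `tensorRank t` is the least number of triads in a decomposition of `t`, not a default.
The tree already holds the mathematics: `exists_triad_decomposition` / `exists_triad_decomposition_tensorRank`
(`Literature/…/FlatteningBound.lean`: a decomposition exists; the infimum is attained) and
`tensorRank_le_card` (`R(t) ≤ |ι|·|κ|·|μ|`).  This file only states the SET-LEVEL facts under the names
and in the shape the generator's side-fact reader looks for (`…_nonempty : S.Nonempty`,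
`…_bddBelow : BddBelow S`, `…_bddBelow_nonempty : BddBelow S ∧ S.Nonempty`, `…_mem : tensorRank t ∈ S`),
each a one-line consequence of those theorems.

Review evidence only (topic module, closes no item); no definitions, no `sorry`, standard axioms.
-/

namespace Summit.MatrixMultiplication.OmegaCensus.Runbook

open Literature.Computability.AlgebraicComplexity

variable {K : Type*} [CommSemiring K] {ι κ μ : Type*}

/-- **The defining set of `tensorRank t` is non-empty** over finite index types: `|ι|·|κ|·|μ|` belongs to
it (the coordinate decomposition `exists_triad_decomposition`, re-indexed by `Fin (|ι × κ × μ|)`).  Over `ℕ`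
this alone makes `sInf` the genuine least element. [folklore] -/
theorem tensorRank_set_nonempty [Fintype ι] [Fintype κ] [Fintype μ] (t : ι → κ → μ → K) :
    {r : ℕ | ∃ (w : Fin r → ι → K) (u : Fin r → κ → K) (v : Fin r → μ → K),
      t = ∑ i, triad (w i) (u i) (v i)}.Nonempty := by
  obtain ⟨r, w, u, v, h⟩ := exists_triad_decomposition t
  exact ⟨r, w, u, v, h⟩

/-- The defining set of `tensorRank t` is bounded below (by `0`, as every set of natural numbers).
[folklore] -/
theorem tensorRank_set_bddBelow (t : ι → κ → μ → K) :
    BddBelow {r : ℕ | ∃ (w : Fin r → ι → K) (u : Fin r → κ → K) (v : Fin r → μ → K),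
      t = ∑ i, triad (w i) (u i) (v i)} :=
  OrderBot.bddBelow _

/-- **Side fact for the §2 card `tensorRank`, in the generator's printed shape**: over finite index types
the defining set of `tensorRank t` is bounded below AND non-empty — `sInf` is its least element, no
conventional value is in play. [folklore] -/
theorem tensorRank_bddBelow_nonempty [Fintype ι] [Fintype κ] [Fintype μ] (t : ι → κ → μ → K) :
    BddBelow {r : ℕ | ∃ (w : Fin r → ι → K) (u : Fin r → κ → K) (v : Fin r → μ → K),
        t = ∑ i, triad (w i) (u i) (v i)} ∧
      {r : ℕ | ∃ (w : Fin r → ι → K) (u : Fin r → κ → K) (v : Fin r → μ → K),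
        t = ∑ i, triad (w i) (u i) (v i)}.Nonempty :=
  ⟨tensorRank_set_bddBelow t, tensorRank_set_nonempty t⟩

/-- **`tensorRank` is attained** — the value is a member of its defining set: over finite index types `t`
IS a sum of exactly `tensorRank t` triads (the tree's `exists_triad_decomposition_tensorRank`, set-phrased).
[folklore] -/
theorem tensorRank_mem [Fintype ι] [Fintype κ] [Fintype μ] (t : ι → κ → μ → K) :
    tensorRank t ∈ {r : ℕ | ∃ (w : Fin r → ι → K) (u : Fin r → κ → K) (v : Fin r → μ → K),
      t = ∑ i, triad (w i) (u i) (v i)} :=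
  exists_triad_decomposition_tensorRank t

end Summit.MatrixMultiplication.OmegaCensus.Runbook
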